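import Summits.QuantumFields.YangMills.Theses.SwapVirialDeficit
import Summits.QuantumFields.YangMills.Theses.ToronValleyVolume
import Summits.QuantumFields.YangMills.Theorems.ToronValleyVolumeLojasiewiczLocalise
import Summits.QuantumFields.YangMills.Theorems.ToronValleyVolumeTauberMeanUpper
import Summits.QuantumFields.YangMills.Theorems.VirialFluxGapDeficitForm
import Summits.QuantumFields.YangMills.Theorems.VirialFluxGapPeriodicSoftnessWindowArithmeticZero
import Summits.QuantumFields.YangMills.Theorems.SwapVirialDeficitLogDerivMixture
import Summits.QuantumFields.YangMills.Theorems.VirialFluxGapTwistedEquipartitionTwoSided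
import Summits.QuantumFields.YangMills.Theorems.VirialFluxGapSharpTwistedLaplaceProof
import Summits.QuantumFields.YangMills.Theorems.FluxSectorLaplaceFluxSectorSuppression
import Summits.QuantumFields.YangMills.Theorems.SwapVirialDeficitSwapMeanActionGapGlue
import HarnessLib

/-!
# Route `SwapVirialDeficit` (YangMills): `ToronTubeVolumeLaw → ToronSoftnessSharp` — the sharp toron softness of the zero-flux ring
# is a consequence of the toron-valley tube volume law (⟨stmt-QuantumFields-24497⟩ ⟹ ⟨stmt-QuantumFields-24196⟩)

LINE «sector-mixture» of planner ym-idea-4 g14 for the crux `SwapVirialDeficit.ToronSoftnessSharp` (item stmt-QuantumFields-24196;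
HOME `pub/ideators/ym-idea-4/bc/g14-B/mix/ToronSoftnessSharp_mixture_birth.lean`, composition `ToronSoftnessSharp_of` kernel-checked by
the planner) has four stubs, three of which are theorems of the tree:

* `stub_logDerivMixture` = ✓`TT.SectorSmooth.logDerivMixture` (`Z = (1/8)Σ_z W_z`, `(log Z)′ = Σ_z p_z (log W_z)′`);
* `stub_twistedEquipartitionLower` = ✓`TwistedEquipartitionTwoSided.twistedEquipartitionLower_of_sharpTwistedLaplace` applied to
  ✓`FixSplit.sharpTwistedLaplace_holds` (⟨24204⟩, proved);
* `stub_fluxSectorSuppression` = ✓`FluxSectorLaplace.fluxSectorSuppression_proof` (⟨24079⟩, proved).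

The fourth, the `∀ε` SHARP PERIODIC SOFTNESS `PeriodicSoftnessEps` of the zero-flux seam sector
(`β·(log W₀)′(β) ≥ 12βL⁴ − 9L⁴ + 3/2 − ε` on a Laplace window `L₀ ≤ L ≤ β^a`, `a = a(ε)`), follows from the OPEN crux
`ToronValleyVolume.ToronTubeVolumeLaw` (⟨24497⟩) exactly as the route `ToronValleyVolume`'s deciding theorem ✓`Theses.ToronValleyVolume.closes`
derives `PeriodicSoftness` with `c = 1`: localise by ✓`ToronValleyVolume.lojasiewiczLocalise_proof` (⟨24498⟩), bound the Gibbs mean of the deficit by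
✓`ToronValleyVolume.toronValleyVolume_tauberMeanUpper_proof` (⟨24499⟩), convert by ✓`RingDeficit.deficitFormZero` — the only new step is that the
Tauberian error `(4ρ+5)·κ·((ρ+2)/β)^θ + 2/β` (`ρ = 9L⁴ − 3/2`, `κ = K′L^{q′}`) is `≤ 410K′β^{−3θ/4} + 2/β → 0` on the window
`a = θ/(4(q′+10))` of ✓`stub_windowArithmeticZero`, so it is `≤ ε` (not merely `≤ 1/2`) for `β ≥ β₀(ε)` (§1 `tauberError_le`).

Results (§2–§3):
* ★★ `periodicSoftnessEps_of_toronTubeVolumeLaw : ToronTubeVolumeLaw → (∀ε periodic softness of W₀)`;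
* ★★★ `toronSoftnessSharp_of_toronTubeVolumeLaw : ToronTubeVolumeLaw → SwapVirialDeficit.ToronSoftnessSharp` (⟨24497⟩ ⟹ ⟨24196⟩ BY NAME);
* ★ `swapMeanActionGap_of_toronTubeVolumeLaw : ToronTubeVolumeLaw → SwapGluedStiffness → SwapMeanActionGap` (with the landed glue
  ✓`SwapVirialDeficit.swapMeanActionGapGlue_proof`): on LINE g14-B the parent crux ⟨24194⟩ now rests on ⟨24497⟩ and ⟨24197⟩ only.

HONEST FRAMING: conditional bookkeeping between OPEN prediction rows of DRAFT lines (`ToronTubeVolumeLaw` ⟨24497⟩, `ToronSoftnessSharp` ⟨24196⟩,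
`SwapGluedStiffness` ⟨24197⟩ all stay OPEN); fixed-lattice transfer-matrix statements on femto windows `L ≤ β^a`; no crux, rung or summit statement
is proved; the Yang–Mills mass gap is NOT proved; no summit is proved by a line.  THEOREMS ONLY (0 `def`, 0 `sorry`), standard axioms.
Seat ym-line-fcl-p3 g43 (cell ym-idea-1, free hands), `--supports stmt-QuantumFields-24196`.
References: [cite: MontvayMunster1994, (3.145)]; [cite: Luscher1983, §2]; [cite: Griffiths1964]; [cite: tHooft1979].
-/

set_option autoImplicit false

noncomputable section

open MeasureTheory Filter Set Function
open scoped BigOperators Topology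

namespace Summit.QuantumFields.YangMills.Theorems.SwapVirialDeficit.SectorMixture

open Summit.QuantumFields.YangMills.Theorems.FemtoTransferGap
open Summit.QuantumFields.YangMills.Theorems.VirialFluxGapPeriodicSoftnessWindow (le_rpow_of_rpow_inv_le)

/-! ## §1 The Tauberian error is `≤ ε` on the window `L ≤ β^{θ/(4(q₁+10))}` -/

/-- ★ On the Laplace window `L ≤ β^{a}`, `a = θ/(4(q₁+10))`, the Tauberian error term
`(4ρ+5)·K₁L^{q₁}·((ρ+2)/β)^θ + 2/β` (`ρ = 9L⁴ − 3/2`) is at most `410K₁β^{−3θ/4} + 2/β`, hence `≤ ε` for `β ≥ β₁(ε)`. [folklore] -/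
theorem tauberError_le {K₁ q₁ θ ε : ℝ} (hK₁ : 0 < K₁) (hq₁ : 0 ≤ q₁) (hθ : 0 < θ) (hθ1 : θ ≤ 1) (hε : 0 < ε) :
    ∃ β₁ : ℝ, ∀ β : ℝ, β₁ ≤ β → ∀ L : ℕ, 1 ≤ L → (L : ℝ) ≤ β ^ (θ / (4 * (q₁ + 10))) →
      (4 * (9 * (L : ℝ) ^ 4 - 3 / 2) + 5) * (K₁ * (L : ℝ) ^ q₁) * ((9 * (L : ℝ) ^ 4 - 3 / 2 + 2) / β) ^ θ + 2 / β ≤ ε := by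
  set a : ℝ := θ / (4 * (q₁ + 10)) with hadef
  have ha0 : 0 < a := by positivity
  have haθ : a ≤ 1 / (4 * (q₁ + 10)) := div_le_div_of_nonneg_right hθ1 (by positivity)
  have hE₂ : 4 * a + a * q₁ + (4 * a - 1) * θ ≤ -(3 * θ / 4) := by
    have ha4 : a * (q₁ + 8) ≤ θ / 4 := by
      rw [hadef, div_mul_eq_mul_div, div_le_div_iff₀ (by positivity) (by norm_num)]
      nlinarith [mul_nonneg hθ.le hq₁]
    nlinarith [mul_nonneg ha0.le hq₁]
  have h34 : 0 < 3 * θ / 4 := by positivity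
  set C : ℝ := 820 * K₁ / ε with hC
  have hC0 : 0 ≤ C := by positivity
  refine ⟨max 1 (max (4 / ε) (C ^ (1 / (3 * θ / 4)))), fun β hβ L hL hLβ => ?_⟩
  have hβ1 : 1 ≤ β := le_trans (le_max_left _ _) hβ
  have hβε : 4 / ε ≤ β := le_trans ((le_max_left _ _).trans (le_max_right _ _)) hβ
  have hβC : C ^ (1 / (3 * θ / 4)) ≤ β := le_trans ((le_max_right _ _).trans (le_max_right _ _)) hβ
  have hβ0 : 0 < β := by linarith
  have hℓ1 : (1 : ℝ) ≤ L := by exact_mod_cast hL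
  have hℓ0 : (0 : ℝ) < L := by linarith
  have hP1 : 1 ≤ (L : ℝ) ^ 4 := one_le_pow₀ hℓ1
  have hR0 : 0 < (L : ℝ) ^ q₁ := by positivity
  have hκ0 : 0 < K₁ * (L : ℝ) ^ q₁ := by positivity
  have hGC : C ≤ β ^ (3 * θ / 4) := le_rpow_of_rpow_inv_le hC0 h34 hβC
  have hG0 : 0 < β ^ (3 * θ / 4) := Real.rpow_pos_of_pos hβ0 _
  -- window monomials
  have hRβ : (L : ℝ) ^ q₁ ≤ β ^ (a * q₁) := by
    calc (L : ℝ) ^ q₁ ≤ (β ^ a) ^ q₁ := Real.rpow_le_rpow hℓ0.le hLβ hq₁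
      _ = β ^ (a * q₁) := by rw [← Real.rpow_mul hβ0.le]
  have hPβ : (L : ℝ) ^ 4 ≤ β ^ (4 * a) := by
    calc (L : ℝ) ^ 4 ≤ (β ^ a) ^ 4 := pow_le_pow_left₀ hℓ0.le hLβ 4
      _ = (β ^ a) ^ ((4 : ℕ) : ℝ) := (Real.rpow_natCast _ 4).symm
      _ = β ^ (4 * a) := by rw [← Real.rpow_mul hβ0.le]; ring_nf
  -- the Laplace factor `D = ((ρ+2)/β)^θ ≤ 10 β^{(4a−1)θ}`
  have hN0 : 0 < 9 * (L : ℝ) ^ 4 - 3 / 2 + 2 := by linarith only [hP1]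
  have hN10 : 9 * (L : ℝ) ^ 4 - 3 / 2 + 2 ≤ 10 * (L : ℝ) ^ 4 := by linarith only [hP1]
  have hD : ((9 * (L : ℝ) ^ 4 - 3 / 2 + 2) / β) ^ θ ≤ 10 * β ^ ((4 * a - 1) * θ) := by
    have h1 : (9 * (L : ℝ) ^ 4 - 3 / 2 + 2) / β ≤ 10 * β ^ (4 * a - 1) := by
      rw [Real.rpow_sub_one hβ0.ne', mul_div_assoc']
      exact div_le_div_of_nonneg_right (hN10.trans (by linarith only [hPβ])) hβ0.le
    calc ((9 * (L : ℝ) ^ 4 - 3 / 2 + 2) / β) ^ θ ≤ (10 * β ^ (4 * a - 1)) ^ θ :=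
          Real.rpow_le_rpow (by positivity) h1 hθ.le
      _ = 10 ^ θ * β ^ ((4 * a - 1) * θ) := by
          rw [Real.mul_rpow (by norm_num) (Real.rpow_nonneg hβ0.le _), ← Real.rpow_mul hβ0.le]
      _ ≤ 10 * β ^ ((4 * a - 1) * θ) := by
          have : (10 : ℝ) ^ θ ≤ 10 ^ (1 : ℝ) := Real.rpow_le_rpow_of_exponent_le (by norm_num) hθ1
          rw [Real.rpow_one] at this
          exact mul_le_mul_of_nonneg_right this (Real.rpow_nonneg hβ0.le _)
  have hD0 : 0 ≤ ((9 * (L : ℝ) ^ 4 - 3 / 2 + 2) / β) ^ θ := Real.rpow_nonneg (by positivity) _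
  -- `L⁴·κ·D ≤ 10K₁ β^{−3θ/4} ≤ 10K₁/C`
  have hnegpow : β ^ (-(3 * θ / 4)) ≤ C⁻¹ := by
    rw [Real.rpow_neg hβ0.le]
    exact inv_anti₀ (by positivity) hGC
  have hPκD : (L : ℝ) ^ 4 * (K₁ * (L : ℝ) ^ q₁) * ((9 * (L : ℝ) ^ 4 - 3 / 2 + 2) / β) ^ θ ≤ 10 * K₁ * C⁻¹ := by
    have h1 : (L : ℝ) ^ 4 * (L : ℝ) ^ q₁ * ((9 * (L : ℝ) ^ 4 - 3 / 2 + 2) / β) ^ θ ≤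
        β ^ (4 * a) * β ^ (a * q₁) * (10 * β ^ ((4 * a - 1) * θ)) :=
      mul_le_mul (mul_le_mul hPβ hRβ hR0.le (Real.rpow_nonneg hβ0.le _)) hD hD0 (by positivity)
    have h2 : β ^ (4 * a) * β ^ (a * q₁) * (10 * β ^ ((4 * a - 1) * θ)) = 10 * β ^ (4 * a + a * q₁ + (4 * a - 1) * θ) := by
      rw [Real.rpow_add hβ0, Real.rpow_add hβ0]; ring
    have h3 : β ^ (4 * a + a * q₁ + (4 * a - 1) * θ) ≤ β ^ (-(3 * θ / 4)) := Real.rpow_le_rpow_of_exponent_le hβ1 hE₂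
    calc (L : ℝ) ^ 4 * (K₁ * (L : ℝ) ^ q₁) * ((9 * (L : ℝ) ^ 4 - 3 / 2 + 2) / β) ^ θ
        = K₁ * ((L : ℝ) ^ 4 * (L : ℝ) ^ q₁ * ((9 * (L : ℝ) ^ 4 - 3 / 2 + 2) / β) ^ θ) := by ring
      _ ≤ K₁ * (10 * β ^ (4 * a + a * q₁ + (4 * a - 1) * θ)) := by rw [← h2]; exact mul_le_mul_of_nonneg_left h1 hK₁.le
      _ ≤ K₁ * (10 * C⁻¹) := by
          refine mul_le_mul_of_nonneg_left ?_ hK₁.le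
          exact mul_le_mul_of_nonneg_left (h3.trans hnegpow) (by norm_num)
      _ = 10 * K₁ * C⁻¹ := by ring
  have hCinv : 410 * K₁ * C⁻¹ = ε / 2 := by
    rw [hC]
    field_simp
    ring
  have h1 : (4 * (9 * (L : ℝ) ^ 4 - 3 / 2) + 5) * (K₁ * (L : ℝ) ^ q₁) * ((9 * (L : ℝ) ^ 4 - 3 / 2 + 2) / β) ^ θ ≤
      41 * ((L : ℝ) ^ 4 * (K₁ * (L : ℝ) ^ q₁) * ((9 * (L : ℝ) ^ 4 - 3 / 2 + 2) / β) ^ θ) := by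
    have e : 41 * ((L : ℝ) ^ 4 * (K₁ * (L : ℝ) ^ q₁) * ((9 * (L : ℝ) ^ 4 - 3 / 2 + 2) / β) ^ θ) =
        (41 * (L : ℝ) ^ 4) * ((K₁ * (L : ℝ) ^ q₁) * ((9 * (L : ℝ) ^ 4 - 3 / 2 + 2) / β) ^ θ) := by ring
    rw [e, mul_assoc]
    exact mul_le_mul_of_nonneg_right (by linarith only [hP1]) (mul_nonneg hκ0.le hD0)
  have h2 : 2 / β ≤ ε / 2 := by
    rw [div_le_div_iff₀ hβ0 (by norm_num)]
    have := (div_le_iff₀ hε).mp hβε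
    linarith
  have h3 : 41 * (10 * K₁ * C⁻¹) = ε / 2 := by rw [← hCinv]; ring
  linarith only [h1, hPκD, h2, h3]

/-! ## §2 The `∀ε` periodic softness from the tube volume law -/

/-- ★★ **`ToronTubeVolumeLaw → PeriodicSoftnessEps`**: for every `ε > 0` there are `a > 0`, `β₀`, `L₀` with
`12βL⁴ − 9L⁴ + 3/2 − ε ≤ β·(log W₀)′(β)` for `β ≥ β₀`, `L₀ ≤ L ≤ β^a` (`W₀(b) = TT.sectorWeight b (2L−1) 0 1`).  The argument is
✓`Theses.ToronValleyVolume.closes` verbatim (localisation by ✓`lojasiewiczLocalise_proof`, mean bound by ✓`toronValleyVolume_tauberMeanUpper_proof`,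
conversion by ✓`deficitFormZero`) with the Tauberian error made `≤ ε` by `tauberError_le`.  Conditional on the OPEN crux ⟨24497⟩.
[cite: MontvayMunster1994, (3.145)] [cite: Luscher1983, §2] -/
theorem periodicSoftnessEps_of_toronTubeVolumeLaw
    (hV : Summit.QuantumFields.YangMills.Theses.ToronValleyVolume.ToronTubeVolumeLaw) :
    ∀ ε : ℝ, 0 < ε → ∃ a : ℝ, 0 < a ∧ ∃ β₀ : ℝ, ∃ L₀ : ℕ, ∀ β : ℝ, β₀ ≤ β → ∀ (L : ℕ) [NeZero L], L₀ ≤ L → (L : ℝ) ≤ β ^ a →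
      12 * β * (L : ℝ) ^ 4 - 9 * (L : ℝ) ^ 4 + 3 / 2 - ε ≤
        β * deriv (fun b : ℝ => Real.log (TT.sectorWeight (L := L) b (2 * L - 1) (fun _ => false) (fun _ _ => (1 : ℝ)))) β := by
  intro ε hε
  have hD := Summit.QuantumFields.YangMills.Theorems.VirialFluxGap.RingDeficit.deficitFormZero
  have hG := Summit.QuantumFields.YangMills.Theorems.ToronValleyVolume.lojasiewiczLocalise_proof
  have hT := Summit.QuantumFields.YangMills.Theorems.ToronValleyVolume.toronValleyVolume_tauberMeanUpper_proof
  obtain ⟨p, hp, K₁, hK₁, q₁, hq₁, θ, hθ, hθ1, v, e, c, L₁, hV⟩ := hV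
  obtain ⟨α, hα, hα1, K, hK, q, hq, L₂, hG⟩ := hG
  -- the single worst constant `K' L^{q'}` with `K' = K₁ + K + K^{1/α}`, `q' = q₁ + q + (q + p)/α`
  have hKα : 0 < K ^ (1 / α) := Real.rpow_pos_of_pos hK _
  have hK'0 : 0 < K₁ + K + K ^ (1 / α) := by positivity
  have hαinv : 0 ≤ 1 / α := by positivity
  have hqpα : 0 ≤ (q + p) / α := by positivity
  have hq'0 : 0 ≤ q₁ + q + (q + p) / α := by positivity
  obtain ⟨a₀, ha₀, β₀, hW⟩ :=
    Summit.QuantumFields.YangMills.Theorems.VirialFluxGapPeriodicSoftnessWindow.stub_windowArithmeticZero (K₁ + K + K ^ (1 / α))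
      (q₁ + q + (q + p) / α) θ hK'0 hq'0 hθ hθ1
  obtain ⟨β₁, hErr⟩ := tauberError_le (ε := ε) hK'0 hq'0 hθ hθ1 hε
  set a : ℝ := min a₀ (θ / (4 * (q₁ + q + (q + p) / α + 10))) with hadef
  have ha : 0 < a := lt_min ha₀ (by positivity)
  refine ⟨a, ha, max (max β₀ β₁) 1, max (max L₁ L₂) 1, ?_⟩
  intro β hβ L _ hL hLwin
  have hββ₀ : β₀ ≤ β := le_trans (le_trans (le_max_left _ _) (le_max_left _ _)) hβ
  have hββ₁ : β₁ ≤ β := le_trans (le_trans (le_max_right _ _) (le_max_left _ _)) hβ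
  have hβ1 : (1 : ℝ) ≤ β := le_trans (le_max_right _ _) hβ
  have hL₁ : L₁ ≤ L := le_trans (le_trans (le_max_left _ _) (le_max_left _ _)) hL
  have hL₂ : L₂ ≤ L := le_trans (le_trans (le_max_right _ _) (le_max_left _ _)) hL
  have hL1 : 1 ≤ L := le_trans (le_max_right _ _) hL
  have hLr : (1 : ℝ) ≤ (L : ℝ) := by exact_mod_cast hL1
  have hL0 : (0 : ℝ) < (L : ℝ) := by linarith
  -- the two windows
  have hLwin₀ : (L : ℝ) ≤ β ^ a₀ := hLwin.trans (Real.rpow_le_rpow_of_exponent_le hβ1 (min_le_left _ _))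
  have hLwin₁ : (L : ℝ) ≤ β ^ (θ / (4 * (q₁ + q + (q + p) / α + 10))) :=
    hLwin.trans (Real.rpow_le_rpow_of_exponent_le hβ1 (min_le_right _ _))
  obtain ⟨hvpos, hepos, hlogv, hvol⟩ := hV L hL₁
  have hGL := hG L hL₂
  obtain ⟨hmeas, hnonneg, hvir⟩ := hD L
  -- monomial bookkeeping
  set κ' : ℝ := (K₁ + K + K ^ (1 / α)) * (L : ℝ) ^ (q₁ + q + (q + p) / α) with hκ'def
  have hκ'pos : 0 < κ' := by positivity
  have hLq₁ : (L : ℝ) ^ q₁ ≤ (L : ℝ) ^ (q₁ + q + (q + p) / α) := Real.rpow_le_rpow_of_exponent_le hLr (by linarith)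
  have hLq : (L : ℝ) ^ q ≤ (L : ℝ) ^ (q₁ + q + (q + p) / α) := Real.rpow_le_rpow_of_exponent_le hLr (by linarith)
  have hL2 : (L : ℝ) ^ ((q + p) / α) ≤ (L : ℝ) ^ (q₁ + q + (q + p) / α) :=
    Real.rpow_le_rpow_of_exponent_le hLr (by linarith)
  have hκ₁ : K₁ * (L : ℝ) ^ q₁ ≤ κ' := mul_le_mul (by linarith [hKα.le]) hLq₁ (by positivity) hK'0.le
  have hκ₂ : K * (L : ℝ) ^ q ≤ κ' := mul_le_mul (by linarith [hKα.le]) hLq (by positivity) hK'0.le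
  have hKLqp : 0 < K * (L : ℝ) ^ (q + p) := by positivity
  have hpow : (K * (L : ℝ) ^ (q + p)) ^ (1 / α) = K ^ (1 / α) * (L : ℝ) ^ ((q + p) / α) := by
    rw [Real.mul_rpow hK.le (by positivity), ← Real.rpow_mul hL0.le]
    congr 2
    field_simp
  have hκ₃ : (K * (L : ℝ) ^ (q + p)) ^ (1 / α) ≤ κ' := by
    rw [hpow]; exact mul_le_mul (by linarith) hL2 (by positivity) hK'0.le
  have hκ₁pos : 0 < K₁ * (L : ℝ) ^ q₁ := by positivity
  have hκ₂pos : 0 < K * (L : ℝ) ^ q := by positivity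
  have hκ₃pos : 0 < (K * (L : ℝ) ^ (q + p)) ^ (1 / α) := Real.rpow_pos_of_pos hKLqp _
  have hLp : 0 < (L : ℝ) ^ p := by positivity
  have hlogv' : |Real.log (v L)| ≤ κ' := hlogv.trans hκ₁
  -- localisation: on `(0, κ'⁻¹]` the sublevel set lies inside the tube, so the tube law is the global law
  have hvol' : ∀ t : ℝ, 0 < t → t ≤ κ'⁻¹ →
      κ'⁻¹ ≤ e L * Real.log t⁻¹ + c L ∧
      |(Summit.QuantumFields.YangMills.Theorems.VirialFluxGap.RingDeficit.ringMeasure L).real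
          {P | Summit.QuantumFields.YangMills.Theorems.VirialFluxGap.RingDeficit.ringDeficit L (fun _ => false) P ≤ t} /
          (v L * t ^ (9 * (L : ℝ) ^ 4 - 3 / 2) * (e L * Real.log t⁻¹ + c L)) - 1| ≤ κ' * t ^ θ := by
    intro t ht htle
    have ht₁ : t ≤ (K₁ * (L : ℝ) ^ q₁)⁻¹ := htle.trans (inv_anti₀ hκ₁pos hκ₁)
    have ht₂ : t ≤ (K * (L : ℝ) ^ q)⁻¹ := htle.trans (inv_anti₀ hκ₂pos hκ₂)
    have ht₃ : t ≤ ((K * (L : ℝ) ^ (q + p)) ^ (1 / α))⁻¹ := htle.trans (inv_anti₀ hκ₃pos hκ₃)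
    obtain ⟨hlow, h⟩ := hvol t ht ht₁
    refine ⟨(inv_anti₀ hκ₁pos hκ₁).trans hlow, ?_⟩
    rw [Set.inter_eq_left.mpr] at h
    · exact h.trans (mul_le_mul_of_nonneg_right hκ₁ (Real.rpow_nonneg ht.le θ))
    · intro P hP
      simp only [Set.mem_setOf_eq] at hP ⊢
      have h1 := hGL P (hP.trans ht₂)
      refine h1.trans ?_
      have hFα : (Summit.QuantumFields.YangMills.Theorems.VirialFluxGap.RingDeficit.ringDeficit L (fun _ => false) P) ^ α ≤
          (K * (L : ℝ) ^ (q + p))⁻¹ := by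
        calc _ ≤ t ^ α := Real.rpow_le_rpow (hnonneg P) hP hα.le
          _ ≤ (((K * (L : ℝ) ^ (q + p)) ^ (1 / α))⁻¹) ^ α := Real.rpow_le_rpow ht.le ht₃ hα.le
          _ = (K * (L : ℝ) ^ (q + p))⁻¹ := by
              rw [Real.inv_rpow hκ₃pos.le, ← Real.rpow_mul hKLqp.le]
              have : 1 / α * α = 1 := by field_simp
              rw [this, Real.rpow_one]
      calc K * (L : ℝ) ^ q * _ ≤ K * (L : ℝ) ^ q * (K * (L : ℝ) ^ (q + p))⁻¹ :=
            mul_le_mul_of_nonneg_left hFα hκ₂pos.le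
        _ = ((L : ℝ) ^ p)⁻¹ := by
            rw [Real.rpow_add hL0]
            field_simp
  -- the window arithmetic, the Tauberian mean bound and the `ε`-error
  obtain ⟨hβ2, hy, hthr, -⟩ := hW β hββ₀ L hL1 hLwin₀ (Real.log (v L)) hlogv'
  have herr := hErr β hββ₁ L hL1 hLwin₁
  have hβpos : 0 < β := by linarith
  have hρ : (1 : ℝ) ≤ 9 * (L : ℝ) ^ 4 - 3 / 2 := by
    have h4 : (1 : ℝ) ≤ (L : ℝ) ^ 4 := one_le_pow₀ hLr
    linarith
  haveI : MeasureTheory.IsProbabilityMeasure (Summit.QuantumFields.YangMills.Theorems.FemtoTransferGap.TT.gaugeMeasure L) :=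
    Summit.QuantumFields.YangMills.Theorems.FemtoTransferGap.TT.isProbabilityMeasure_gaugeMeasure (L := L)
  haveI : MeasureTheory.IsProbabilityMeasure (Summit.QuantumFields.YangMills.Theorems.VirialFluxGap.RingDeficit.ringMeasure L) := by
    unfold Summit.QuantumFields.YangMills.Theorems.VirialFluxGap.RingDeficit.ringMeasure; infer_instance
  have hT' := hT _ (Summit.QuantumFields.YangMills.Theorems.VirialFluxGap.RingDeficit.ringMeasure L)
    (Summit.QuantumFields.YangMills.Theorems.VirialFluxGap.RingDeficit.ringDeficit L (fun _ => false)) (9 * (L : ℝ) ^ 4 - 3 / 2)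
    (v L) (e L) (c L) κ' θ κ'⁻¹ κ'⁻¹
    hmeas hnonneg hρ hvpos hepos hκ'pos.le hθ hθ1 (inv_pos.mpr hκ'pos) (inv_pos.mpr hκ'pos) hvol' β hβ2 hy hthr
  rw [hvir β hβpos]
  linarith

/-! ## §3 The composition of LINE «sector-mixture» (planner ym-idea-4 g14, kernel-checked there), run with the landed stubs -/

/-- ★★★ **`ToronTubeVolumeLaw → ToronSoftnessSharp`** (⟨stmt-QuantumFields-24497⟩ ⟹ ⟨stmt-QuantumFields-24196⟩ BY NAME).  The zero-flux ring
trace is the mixture `Z = (1/8)Σ_z W_z` (✓`logDerivMixture`); the `z = 0` sector is `∀ε`-sharply soft (§2, from the tube volume law), every twisted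
sector obeys the lower half of equipartition (✓`twistedEquipartitionLower_of_sharpTwistedLaplace` ∘ ✓`sharpTwistedLaplace_holds`), and carries
probability `p_z ≤ β^{−a}/8` (✓`fluxSectorSuppression_proof`), so `β(log Z)′ = Σ_z p_z·β(log W_z)′ ≥ 12βL⁴ − 9L⁴ + 3/2 − ε` on a window.
Conditional on the OPEN crux ⟨24497⟩; no crux / rung / summit is proved; the YM mass gap is NOT proved.
[cite: MontvayMunster1994, (3.145)] [cite: Griffiths1964] [cite: tHooft1979] -/
theorem toronSoftnessSharp_of_toronTubeVolumeLaw
    (hV : Summit.QuantumFields.YangMills.Theses.ToronValleyVolume.ToronTubeVolumeLaw) :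
    Summit.QuantumFields.YangMills.Theses.SwapVirialDeficit.ToronSoftnessSharp := by
  have h1 := Summit.QuantumFields.YangMills.Theorems.FemtoTransferGap.TT.SectorSmooth.logDerivMixture
  have h2 := periodicSoftnessEps_of_toronTubeVolumeLaw hV
  have h3 := Summit.QuantumFields.YangMills.Theorems.VirialFluxGap.TwistedEquipartitionTwoSided.twistedEquipartitionLower_of_sharpTwistedLaplace
    Summit.QuantumFields.YangMills.Theorems.VirialFluxGap.FixSplit.sharpTwistedLaplace_holds
  have h4 := Summit.QuantumFields.YangMills.Theorems.FluxSectorLaplace.fluxSectorSuppression_proof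
  intro ε hε
  obtain ⟨a₂, ha₂, β₂, L₂, hP⟩ := h2 (ε / 2) (by linarith)
  obtain ⟨a₃, ha₃, β₃, L₃, hTw⟩ := h3 (ε / 2) (by linarith)
  obtain ⟨a₄, ha₄, β₄, L₄, hF⟩ := h4
  -- β^{-a₄} → 0
  have hev : ∀ᶠ β : ℝ in atTop, β ^ (-a₄) < 8 * ε / 21 := by
    have ht : Tendsto (fun β : ℝ => β ^ (-a₄)) atTop (𝓝 0) := tendsto_rpow_neg_atTop ha₄
    exact ht.eventually (gt_mem_nhds (by linarith))
  obtain ⟨β₅, hβ₅⟩ := Filter.eventually_atTop.mp hev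
  set a : ℝ := min a₂ (min a₃ a₄) with ha_def
  have ha : 0 < a := lt_min ha₂ (lt_min ha₃ ha₄)
  refine ⟨a, ha, max (max β₂ β₃) (max (max β₄ β₅) 1), max L₂ (max L₃ L₄), ?_⟩
  intro β hβ L _ hL hLwin
  have hβ₂ : β₂ ≤ β := le_trans (le_trans (le_max_left _ _) (le_max_left _ _)) hβ
  have hβ₃ : β₃ ≤ β := le_trans (le_trans (le_max_right _ _) (le_max_left _ _)) hβ
  have hβ₄ : β₄ ≤ β := le_trans (le_trans (le_trans (le_max_left _ _) (le_max_left _ _)) (le_max_right _ _)) hβ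
  have hβ₅' : β₅ ≤ β := le_trans (le_trans (le_trans (le_max_right _ _) (le_max_left _ _)) (le_max_right _ _)) hβ
  have hβ1 : (1 : ℝ) ≤ β := le_trans (le_trans (le_max_right _ _) (le_max_right _ _)) hβ
  have hL₂ : L₂ ≤ L := le_trans (le_max_left _ _) hL
  have hL₃ : L₃ ≤ L := le_trans (le_trans (le_max_left _ _) (le_max_right _ _)) hL
  have hL₄ : L₄ ≤ L := le_trans (le_trans (le_max_right _ _) (le_max_right _ _)) hL
  -- windows
  have hwin : ∀ a' : ℝ, a ≤ a' → (L : ℝ) ≤ β ^ a' := fun a' h =>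
    le_trans hLwin (Real.rpow_le_rpow_of_exponent_le hβ1 h)
  have hLa₂ : (L : ℝ) ≤ β ^ a₂ := hwin a₂ (min_le_left _ _)
  have hLa₃ : (L : ℝ) ≤ β ^ a₃ := hwin a₃ (le_trans (min_le_right _ _) (min_le_left _ _))
  have hLa₄ : (L : ℝ) ≤ β ^ a₄ := hwin a₄ (le_trans (min_le_right _ _) (min_le_right _ _))
  have hsmall : β ^ (-a₄) < 8 * ε / 21 := hβ₅ β hβ₅'
  -- the mixture
  obtain ⟨p, hp0, hp1, hpW, hder⟩ := h1 L β
  have hZpos : 0 < TT.physTrace L β (2 * L) :=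
    ((Summit.QuantumFields.YangMills.Theorems.swapVirialDeficit_ringTraceSmooth_proof L (2 * L)).2.2 β).1
  set z0 : Fin 3 → Bool := fun _ => false with hz0
  set M : ℝ := 12 * β * (L : ℝ) ^ 4 - 9 * (L : ℝ) ^ 4 with hM
  set d : (Fin 3 → Bool) → ℝ := fun z =>
    deriv (fun b : ℝ => Real.log (TT.sectorWeight (L := L) b (2 * L - 1) z (fun _ _ => (1 : ℝ)))) β with hd
  -- sector bounds
  have hX0 : M + 3 / 2 - ε / 2 ≤ β * d z0 := by
    have := hP β hβ₂ L hL₂ hLa₂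
    simpa [hM, hd, hz0] using this
  have hXz : ∀ z, M - ε / 2 ≤ β * d z := by
    intro z
    by_cases hz : z = z0
    · subst hz; linarith
    · have := hTw β hβ₃ L hL₃ hLa₃ z (by simpa [hz0] using hz)
      simpa [hM, hd] using this
  -- flux suppression ⇒ p_z ≤ β^{-a₄}/8 for z ≠ z0
  have hpz : ∀ z, z ≠ z0 → p z ≤ β ^ (-a₄) / 8 := by
    intro z hz
    have hWle := hF β hβ₄ L hL₄ hLa₄ z (by simpa [hz0] using hz)
    rw [hpW z] at hWle
    have : p z * 8 ≤ β ^ (-a₄) := by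
      have h8Z : 0 < 8 * TT.physTrace L β (2 * L) := by positivity
      nlinarith [hWle, hZpos]
    linarith
  -- Σ_{z ≠ z0} p_z ≤ 7 β^{-a₄}/8 and p z0 ≥ 1 − that
  have hcard : (Finset.univ.erase z0).card = 7 := by
    rw [Finset.card_erase_of_mem (Finset.mem_univ _)]
    simp
  have hsum_erase : ∑ z ∈ Finset.univ.erase z0, p z ≤ 7 * (β ^ (-a₄) / 8) := by
    have := Finset.sum_le_card_nsmul (Finset.univ.erase z0) p (β ^ (-a₄) / 8)
      (fun z hz => hpz z (Finset.ne_of_mem_erase hz))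
    rw [hcard] at this
    simpa [nsmul_eq_mul] using this
  have hp0_split : p z0 + ∑ z ∈ Finset.univ.erase z0, p z = 1 := by
    rw [Finset.add_sum_erase _ _ (Finset.mem_univ z0)]; exact hp1
  have hp0_lb : 1 - 7 * (β ^ (-a₄) / 8) ≤ p z0 := by linarith
  -- convex-combination estimate
  have hmain : (M - ε / 2) + 3 / 2 * p z0 ≤ ∑ z, p z * (β * d z) := by
    have hpt : ∀ z ∈ (Finset.univ : Finset (Fin 3 → Bool)),
        p z * (M - ε / 2) + (if z = z0 then 3 / 2 * p z else 0) ≤ p z * (β * d z) := by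
      intro z _
      by_cases hz : z = z0
      · subst hz; simp only [if_true]; nlinarith [hX0, hp0 z0]
      · simp only [hz, if_false]; nlinarith [hXz z, hp0 z]
    have hS := Finset.sum_le_sum hpt
    rw [Finset.sum_add_distrib, Finset.sum_ite_eq' Finset.univ z0, if_pos (Finset.mem_univ _), ← Finset.sum_mul, hp1,
      one_mul] at hS
    exact hS
  -- assemble
  have hrew : β * deriv (fun b : ℝ => Real.log (TT.physTrace L b (2 * L))) β = ∑ z, p z * (β * d z) := by
    rw [hder, Finset.mul_sum]
    refine Finset.sum_congr rfl fun z _ => ?_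
    simp only [hd]; ring
  rw [hrew]
  have hnn : 0 ≤ β ^ (-a₄) := Real.rpow_nonneg (by linarith) _
  nlinarith [hmain, hp0_lb, hsmall, hnn]

/-- ★ **`ToronTubeVolumeLaw → SwapGluedStiffness → SwapMeanActionGap`**: with the landed one-line glue
✓`SwapVirialDeficit.swapMeanActionGapGlue_proof`, the parent crux ⟨stmt-QuantumFields-24194⟩ of LINE g14-B rests on the tube volume law ⟨24497⟩
and the swap-glued stiffness ⟨24197⟩ only.  Conditional; no crux / rung / summit is proved; the YM mass gap is NOT proved. [cite: tHooft1979] -/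
theorem swapMeanActionGap_of_toronTubeVolumeLaw
    (hV : Summit.QuantumFields.YangMills.Theses.ToronValleyVolume.ToronTubeVolumeLaw)
    (hS : Summit.QuantumFields.YangMills.Theses.SwapVirialDeficit.SwapGluedStiffness) :
    Summit.QuantumFields.YangMills.Theses.SwapVirialDeficit.SwapMeanActionGap :=
  Summit.QuantumFields.YangMills.Theorems.SwapVirialDeficit.swapMeanActionGapGlue_proof
    (toronSoftnessSharp_of_toronTubeVolumeLaw hV) hS

end Summit.QuantumFields.YangMills.Theorems.SwapVirialDeficit.SectorMixture

end
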